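import Summits.CriticalPhenomena.CardyFormulaZ2.Theorems.CardyTensorRGPolyominoGaussianLawStubDilatedCopy
import Summits.CriticalPhenomena.CardyFormulaZ2.Theorems.CardyTensorRGPolyominoGaussianLawStubScalingIdentity
import Summits.CriticalPhenomena.CardyFormulaZ2.Theorems.CardyTensorRGPolyominoGaussianLawStubDilationEquicontinuity

/-!
# Mesh equicontinuity of bond-`ℤ²` crossing probabilities of polyomino conformal rectangles
# (crux `PolyominoGaussianLaw`, stmt-CriticalPhenomena-14337, route `CardyTensorRG`, line `registered`)

This file closes the THIRD stub of the planner's birth skeleton v1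
(`Cruxes/PolyominoGaussianLaw/Lines/birth.lean`, stub `stub_meshEquicontinuity`): for a polyomino
conformal rectangle `R` (carrier = interior of a finite union of closed `δ₀`-squares, marks at
`δ₀`-lattice points) the bond-`ℤ²` crossing probability `P(δ) = bondDomainCrossingProb R δ`, as a
function of the mesh, has vanishing oscillation over the mesh windows `[δ, ρ δ]` near `0`:
for every `ε > 0` there are `ρ > 1` and `δ₁ > 0` with `|P δ' − P δ| ≤ ε` whenever
`0 < δ ≤ δ' ≤ ρ δ` and `δ' < δ₁`.

Proof (the lead's reshape v2 of that stub, all three pieces now theorems of the tree): with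
`t = δ/δ' ∈ [1/ρ, 1]`, the dilate `t · R` is a conformal rectangle (`stub_dilatedCopy`), the
discretisation is exactly scale covariant, `P_R(δ') = P_{t·R}(t δ') = P_{t·R}(δ)`
(`stub_scalingIdentity`), and at the common mesh `δ < δ₁` the crossing probabilities of `R` and of
its dilates `t · R`, `t ∈ [1/ρ, 1]`, differ by at most `ε` (`stub_dilationEquicontinuity`:
Schramm–Smirnov's continuity (5.1) of quad-crossing events for critical bond percolation on `ℤ²`,
Ann. Probab. 39 (2011), Lemma 5.1, plus a deterministic sandwich between the discrete-arc crossing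
events of the discretised polyomino and the crossing events of perturbed quads of a square model).

It gives NEITHER existence NOR the value of the limit `δ → 0⁺` (e.g. `δ ↦ sin (log (log (1/δ)))`
has the property); in the skeleton it transports limits along the blocking orbits `δ₀/(q·2^k)` to
the full one-sided limit.
-/

namespace Summit.CriticalPhenomena.CardyFormulaZ2.Cruxes.PolyominoGaussianLaw.Birth

/-- **Mesh equicontinuity** (registered stub `stub_meshEquicontinuity` of the birth skeleton v1 of the
crux `PolyominoGaussianLaw`, verbatim). For a polyomino conformal rectangle the bond-ℤ² crossing
probability, as a function of the mesh, has vanishing oscillation over mesh windows `[δ, ρ δ]` near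
`0`: for every `ε > 0` there are `ρ > 1` and `δ₁ > 0` with `|P δ' − P δ| ≤ ε` whenever
`0 < δ ≤ δ' ≤ ρ δ` and `δ' < δ₁`. Proof: `P_R(δ') = P_{t·R}(δ)` for `t = δ/δ' ∈ [1/ρ, 1]`
(`stub_dilatedCopy`, `stub_scalingIdentity`) and dilation equicontinuity at the common mesh
(`stub_dilationEquicontinuity`, Schramm–Smirnov 2011, Lemma 5.1 / (5.1)). [folklore] -/
theorem stub_meshEquicontinuity :
    ∀ R : Literature.Probability.RandomPlanarGeometry.ConformalRectangle,
      (∃ δ₀ : ℝ, 0 < δ₀ ∧ (∃ s : Finset (ℤ × ℤ), R.carrier = interior (⋃ p ∈ s, {z : ℂ |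
        δ₀ * (p.1 : ℝ) ≤ z.re ∧ z.re ≤ δ₀ * ((p.1 : ℝ) + 1) ∧ δ₀ * (p.2 : ℝ) ≤ z.im ∧
        z.im ≤ δ₀ * ((p.2 : ℝ) + 1)})) ∧ ∀ i, ∃ m n : ℤ, R.pt i = (δ₀ : ℂ) * ((m : ℂ) + (n : ℂ) * Complex.I)) →
      ∀ ε : ℝ, 0 < ε → ∃ ρ : ℝ, 1 < ρ ∧ ∃ δ₁ : ℝ, 0 < δ₁ ∧ ∀ δ δ' : ℝ, 0 < δ → δ ≤ δ' → δ' ≤ ρ * δ →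
        δ' < δ₁ → |Literature.Probability.Percolation.bondDomainCrossingProb R δ' -
          Literature.Probability.Percolation.bondDomainCrossingProb R δ| ≤ ε := by
  intro R hR ε hε
  obtain ⟨ρ, hρ, δ₁, hδ₁, h⟩ := stub_dilationEquicontinuity R hR ε hε
  refine ⟨ρ, hρ, δ₁, hδ₁, fun δ δ' hδ hle hle' hlt => ?_⟩
  have hδ' : 0 < δ' := lt_of_lt_of_le hδ hle
  have hρ0 : 0 < ρ := lt_trans one_pos hρ
  set t : ℝ := δ / δ' with ht_def
  have ht : 0 < t := div_pos hδ hδ'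
  have ht1 : t ≤ 1 := (div_le_one hδ').2 hle
  have htρ : 1 / ρ ≤ t := by
    rw [ht_def, div_le_div_iff₀ hρ0 hδ', one_mul]
    linarith [hle']
  obtain ⟨R', hcar, harc⟩ := stub_dilatedCopy R t ht
  have htδ : t * δ' = δ := by
    rw [ht_def]; field_simp
  have key : Literature.Probability.Percolation.bondDomainCrossingProb R δ' =
      Literature.Probability.Percolation.bondDomainCrossingProb R' δ := by
    have hs := stub_scalingIdentity R.carrier (R.arc 0) (R.arc 2) δ' t ht
    rw [htδ] at hs
    unfold Literature.Probability.Percolation.bondDomainCrossingProb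
    rw [hcar, harc 0, harc 2]
    exact hs.symm
  rw [key]
  exact h t htρ ht1 R' hcar (harc 0) (harc 2) δ hδ (lt_of_le_of_lt hle hlt)

end Summit.CriticalPhenomena.CardyFormulaZ2.Cruxes.PolyominoGaussianLaw.Birth
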